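import Summits.NavierStokesRegularity.NavierStokesRegularity.Theorems.GaldiLiouvilleGateRecordZoomAncientStubZoomLimit
import Literature.Analysis.FluidPDE.SelfSimilarProofs
import HarnessLib

/-!
# Route `GaldiLiouvilleGate`, crux `RecordZoomAncient` (stmt-NavierStokesRegularity-0894),
  line `registered` (birth skeleton, reshape r7) — stub `stub_normalise`

**Statement.** A bounded ancient mild solution `v` of the Navier–Stokes system (viscosity `1`),
smooth on `(−∞, 0) × ℝ³`, with `∫ |∇v(s)|² ≤ D'` and `v(s) ∈ L⁶` for all `s < 0` and a nonzero
value at some negative time, yields a bounded ancient mild solution `w` (viscosity `1`), smooth on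
`(−∞, 0) × ℝ³`, with `∫ |∇w(s)|² ≤ 1` and `w(s) ∈ L⁶` for all `s < 0`, not identically zero on
`(−∞, 0) × ℝ³` — the normalised witness of the crux.

**Proof (Navier–Stokes scaling, Leray 1934, §20; KNSS 2009, §1).** Put `w = nsRescale c v`,
`w(t, x) = c v(c² t, c x)`, with `c = 1` if `D' ≤ 1` and `c = D'⁻¹ ∈ (0, 1)` otherwise, so that
`c · max(D', 0) ≤ 1`. Bounded ancient mild solutions are scale invariant
(`IsBoundedAncientMildSolution.nsRescale`, `IsAncientMildSolution.nsRescale_holds`); joint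
smoothness is preserved because `(t, x) ↦ (c² t, c x)` is smooth and maps `(−∞, 0) × ℝ³` into
itself; the Dirichlet integral scales by `c⁴ · c⁻³ = c`
(`lintegral_frobeniusNormSq_fderiv_smul_comp_space_affine`), so `∫ |∇w(s)|² ≤ c D' ≤ 1`; the
`L⁶` norm of a slice scales by a finite factor (`eLpNorm_comp_space_affine`); and
`w(s₀/c², y₀/c) = c v(s₀, y₀) ≠ 0`.
-/

noncomputable section

open Set MeasureTheory Filter Topology Function Literature.Analysis.FluidPDE
open scoped ENNReal NNReal

namespace Summit.NavierStokesRegularity.NavierStokesRegularity.Theorems.RecordZoomAncient.Birth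

-- the problem-side namespace `Summit.NavierStokesRegularity.NavierStokesRegularity.…` (summit =
-- problem for this single-problem summit) duplicates `NavierStokesRegularity` by design
set_option linter.dupNamespace false

/-- The slices of the rescaled field: `(nsRescale c v) s = c • v(c² s, 0 + c ·)` (the shape of
`lintegral_frobeniusNormSq_fderiv_smul_comp_space_affine` / `eLpNorm_comp_space_affine`). -/
theorem nsRescale_slice_eq (c : ℝ)
    (v : ℝ → EuclideanSpace ℝ (Fin 3) → EuclideanSpace ℝ (Fin 3)) (s : ℝ) :
    nsRescale c v s = c • fun y => v (c ^ 2 * s) (0 + c • y) := by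
  funext y
  rw [Pi.smul_apply, zero_add, nsRescale_apply]

/-- **Scaling step of `stub_normalise`.** For `0 < c` with `ofReal c * ofReal D' ≤ 1`, the
rescaled field `nsRescale c v` of a bounded ancient mild solution `v` (viscosity `1`), smooth on
`(−∞, 0) × ℝ³`, with enstrophy `≤ D'`, `L⁶` slices and a nonzero value at a negative time, is
the normalised witness: bounded ancient mild, smooth, enstrophy `≤ 1`, `L⁶` slices, nonzero. -/
theorem normalise_nsRescale
    (v : ℝ → EuclideanSpace ℝ (Fin 3) → EuclideanSpace ℝ (Fin 3)) (D' : ℝ) {c : ℝ} (hc : 0 < c)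
    (hcD : ENNReal.ofReal c * ENNReal.ofReal D' ≤ 1)
    (hv : IsBoundedAncientMildSolution 1 v)
    (hsm : ContDiffOn ℝ (⊤ : ℕ∞) (Function.uncurry v) (Set.Iio 0 ×ˢ Set.univ))
    (hens : ∀ s < 0,
      ∫⁻ y, ENNReal.ofReal (frobeniusNormSq (fderiv ℝ (v s) y)) ≤ ENNReal.ofReal D')
    (hL6 : ∀ s < 0, MemLp (v s) 6 volume) (hnz : ∃ s < 0, ∃ y, v s y ≠ 0) :
    IsBoundedAncientMildSolution 1 (nsRescale c v) ∧
      ContDiffOn ℝ (⊤ : ℕ∞) (Function.uncurry (nsRescale c v)) (Set.Iio 0 ×ˢ Set.univ) ∧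
      (∀ s < 0, ∫⁻ y, ENNReal.ofReal (frobeniusNormSq (fderiv ℝ (nsRescale c v s) y)) ≤ 1) ∧
      (∀ s < 0, MemLp (nsRescale c v s) 6 volume) ∧ ¬ (∀ s < 0, ∀ y, nsRescale c v s y = 0) := by
  have hc2 : 0 < c ^ 2 := by positivity
  have hneg : ∀ s < 0, c ^ 2 * s < 0 := fun s hs => mul_neg_of_pos_of_neg hc2 hs
  -- joint smoothness is `IsSmoothSpaceTimeOn (Iio 0) v`; slices are smooth
  have hS : IsSmoothSpaceTimeOn (Iio 0) v := hsm
  have hslice : ∀ s < 0, ContDiff ℝ (⊤ : ℕ∞) (v s) := fun s hs =>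
    hS.contDiff_slice (mem_Iio.2 hs)
  have hdiff : ∀ s < 0, Differentiable ℝ (v s) := fun s hs =>
    (hslice s hs).differentiable (by simp)
  refine ⟨hv.nsRescale IsAncientMildSolution.nsRescale_holds one_pos hc, ?_, ?_, ?_, ?_⟩
  · -- ### smoothness: compose with the smooth self-map `(t, x) ↦ (c² t, c x)` of `(−∞,0) × ℝ³`
    have hφ : ContDiff ℝ (⊤ : ℕ∞)
        (fun q : ℝ × EuclideanSpace ℝ (Fin 3) => (c ^ 2 * q.1, c • q.2)) :=
      (contDiff_const.mul contDiff_fst).prodMk (contDiff_snd.const_smul c)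
    have hmaps : MapsTo (fun q : ℝ × EuclideanSpace ℝ (Fin 3) => (c ^ 2 * q.1, c • q.2))
        (Set.Iio 0 ×ˢ Set.univ) (Set.Iio 0 ×ˢ Set.univ) := by
      rintro ⟨t, x⟩ ⟨ht, -⟩
      exact ⟨hneg t ht, mem_univ _⟩
    have h := (hsm.comp hφ.contDiffOn hmaps).const_smul c
    refine h.congr fun q _ => ?_
    rcases q with ⟨t, x⟩
    simp only [Function.uncurry_apply_pair, Function.comp_apply, nsRescale_apply]
  · -- ### enstrophy: `∫ |∇w(s)|² = c⁴ c⁻³ ∫ |∇v(c² s)|² ≤ c D' ≤ 1`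
    intro s hs
    rw [nsRescale_slice_eq,
      lintegral_frobeniusNormSq_fderiv_smul_comp_space_affine hc c 0 (hdiff _ (hneg s hs)),
      finrank_euclideanSpace_fin, ← ENNReal.ofReal_mul (by positivity)]
    have hcc : (c * c) ^ 2 * (c ^ 3)⁻¹ = c := by field_simp
    rw [hcc]
    calc ENNReal.ofReal c * ∫⁻ x, ENNReal.ofReal (frobeniusNormSq (fderiv ℝ (v (c ^ 2 * s)) x))
        ≤ ENNReal.ofReal c * ENNReal.ofReal D' := by gcongr; exact hens _ (hneg s hs)
      _ ≤ 1 := hcD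
  · -- ### `L⁶` slices: change of variables
    intro s hs
    rw [nsRescale_slice_eq]
    refine MemLp.const_smul ⟨?_, ?_⟩ c
    · exact ((hslice _ (hneg s hs)).continuous.comp
        (continuous_const.add (continuous_id.const_smul c))).aestronglyMeasurable
    · rw [eLpNorm_comp_space_affine hc 0 (v (c ^ 2 * s)) 6]
      exact ENNReal.mul_lt_top
        (ENNReal.rpow_lt_top_of_nonneg (by positivity) ENNReal.ofReal_ne_top)
        (hL6 _ (hneg s hs)).eLpNorm_lt_top
  · -- ### non-triviality: `w(s₀/c², y₀/c) = c v(s₀, y₀) ≠ 0`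
    obtain ⟨s₀, hs₀, y₀, hy₀⟩ := hnz
    intro hzero
    have h := hzero (s₀ / c ^ 2) (div_neg_of_neg_of_pos hs₀ hc2) (c⁻¹ • y₀)
    rw [nsRescale_apply, mul_div_cancel₀ _ hc2.ne', smul_inv_smul₀ hc.ne',
      smul_eq_zero] at h
    exact h.elim (fun h0 => hc.ne' h0) hy₀

/-- **S4 `stub_normalise` (scaling).** A bounded ancient mild solution `v` (`ν = 1`), smooth on
`(−∞, 0) × ℝ³`, with `∫ |∇v(s)|² ≤ D'` and `v(s) ∈ L⁶` for all `s < 0` and a nonzero value at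
some negative time, yields — by the Navier–Stokes scaling `w = nsRescale c v = c v(c² ·, c ·)`
with `c = 1` (`D' ≤ 1`) or `c = D'⁻¹` (`1 < D'`) — the normalised witness of the crux
(`normalise_nsRescale`). -/
theorem stub_normalise :
    ∀ (v : ℝ → EuclideanSpace ℝ (Fin 3) → EuclideanSpace ℝ (Fin 3)) (D' : ℝ),
      IsBoundedAncientMildSolution 1 v →
      ContDiffOn ℝ (⊤ : ℕ∞) (Function.uncurry v) (Set.Iio 0 ×ˢ Set.univ) →
      (∀ s < 0, ∫⁻ y, ENNReal.ofReal (frobeniusNormSq (fderiv ℝ (v s) y)) ≤ ENNReal.ofReal D') →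
      (∀ s < 0, MemLp (v s) 6 volume) →
      (∃ s < 0, ∃ y, v s y ≠ 0) →
      ∃ w : ℝ → EuclideanSpace ℝ (Fin 3) → EuclideanSpace ℝ (Fin 3),
        IsBoundedAncientMildSolution 1 w ∧
        ContDiffOn ℝ (⊤ : ℕ∞) (Function.uncurry w) (Set.Iio 0 ×ˢ Set.univ) ∧
        (∀ s < 0, ∫⁻ y, ENNReal.ofReal (frobeniusNormSq (fderiv ℝ (w s) y)) ≤ 1) ∧
        (∀ s < 0, MemLp (w s) 6 volume) ∧ ¬ (∀ s < 0, ∀ y, w s y = 0) := by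
  intro v D' hv hsm hens hL6 hnz
  by_cases hD : D' ≤ 1
  · refine ⟨nsRescale 1 v, normalise_nsRescale v D' one_pos ?_ hv hsm hens hL6 hnz⟩
    rw [ENNReal.ofReal_one, one_mul]
    exact ENNReal.ofReal_le_one.2 hD
  · have hD' : 0 < D' := zero_lt_one.trans (not_le.1 hD)
    refine ⟨nsRescale D'⁻¹ v, normalise_nsRescale v D' (inv_pos.2 hD') ?_ hv hsm hens hL6 hnz⟩
    rw [← ENNReal.ofReal_mul (inv_pos.2 hD').le, inv_mul_cancel₀ hD'.ne', ENNReal.ofReal_one]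

end Summit.NavierStokesRegularity.NavierStokesRegularity.Theorems.RecordZoomAncient.Birth

end
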